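import Literature.NumberTheory.Sieve.MaynardSimplexIntegrals
import Mathlib.MeasureTheory.Integral.Prod
import Mathlib.Analysis.SpecialFunctions.Integrals.Basic
import HarnessLib

/-!
# Maynard's Proposition 4.3 (1): `M_5 > 2` (discharge of `exists_two_lt_maynardFunctional_five`)

J. Maynard, *Small gaps between primes*, Ann. of Math. (2) 181 (2015), 383–413 = arXiv:1311.4600,
§7 ("Choice of weight for small `k`"), proof of parts (i) and (ii) of Proposition 4.3 (p. 16 of the
arXiv text): *"we take `k = 5` and `P = (1 − P₁)P₂ + 7/10 (1 − P₁)² + 1/14 P₂ − 3/14 (1 − P₁)`.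
With this choice we find that `M_5 ≥ (∑ₘ J_k^{(m)}(F)) / I_k(F) = 1417255/708216 > 2`"*, where
`F = 1_{R_k} · P` ((7.3)), `P₁ = ∑ tᵢ`, `P₂ = ∑ tᵢ²`.

This file carries out that computation with exact arithmetic, for the tree's definitions
`Literature.NumberTheory.Sieve.maynardI`, `Literature.NumberTheory.Sieve.maynardJ`, `Literature.NumberTheory.Sieve.maynardFunctional`, `Literature.NumberTheory.Sieve.IsMaynardAdmissible`
(`Literature/NumberTheory/Sieve/MaynardTao.lean`), and so discharges the named fact
`Literature.NumberTheory.Sieve.exists_two_lt_maynardFunctional_five` (Maynard Prop. 4.3 (1)):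
`Literature.NumberTheory.Sieve.exists_two_lt_maynardFunctional_five_holds`.

Steps (Maynard, proof of Lemma 7.2):
* `I_5(F) = ∫_{R_5} P²`: expand `P²` into the nine monomials `(1 − P₁)^a P₂^b`, `b ≤ 2`, and use the
  moments of Lemma 7.1 (`MaynardSimplexIntegrals`): `I_5(F) = 29509/1222452000`
  (`maynardI_maynardF5`).
* `J_5^{(m)}(F)`: after splitting off the coordinate `t_m` (`maynardJ_indicator_eq`, Fubini with
  `MeasurableEquiv.piFinSuccAbove`), the inner integral is
  `∫₀^{w} P dt_m = P₂' (w²/2 + w/14) + (w⁴/12 + 9/35 w³ − 3/28 w²)` with `w = 1 − P₁'`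
  (display (7.18) of the arXiv text for this `P`; `integral_maynardPoly5`), and integrating its square
  over `R_4` with Lemma 7.1 gives `J_5^{(m)}(F) = 40493/4191264000` for each `m`
  (`maynardJ_maynardF5`).
* Hence `(∑ₘ J_5^{(m)}(F)) / I_5(F) = 5 · 40493/4191264000 · 1222452000/29509 = 1417255/708216`
  (`maynardFunctional_maynardF5`), exactly the value printed by Maynard, and `> 2`.

## References

* J. Maynard, *Small gaps between primes*, Ann. of Math. (2) 181 (2015), 383–413,
  doi:10.4007/annals.2015.181.1.7 = arXiv:1311.4600; Proposition 4.3 (1), §7 (7.3), Lemmas 7.1, 7.2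
  and the closing computation (7.21)–(7.22). [cite: MaynardAnnals2015]
-/

noncomputable section

open MeasureTheory Set Filter intervalIntegral
open scoped ENNReal Nat

namespace Literature.NumberTheory.Sieve

namespace MaynardTao

/-! ### `I_k`, `J_k^{(m)}` and admissibility for test functions `F = 1_{R_k} · P` -/

/-- Fubini for `J_{n+1}^{(m)}`: split off the coordinate `t_m` (`e.symm (x, s) = Fin.insertNth m x s`
for `e = MeasurableEquiv.piFinSuccAbove _ m`); the integrand of `maynardJ` does not depend on `t_m`,
whose fibre `[0, 1]` has length `1`. [cite: MaynardAnnals2015, definition of J_k^{(m)} before Prop. 4.1] -/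
theorem maynardJ_succ_eq {n : ℕ} (m : Fin (n + 1)) (F : (Fin (n + 1) → ℝ) → ℝ) :
    maynardJ (n + 1) m F = ∫ s in maynardCube n,
      (∫ u in (0:ℝ)..1, (maynardSimplex (n + 1)).indicator F (Fin.insertNth m u s)) ^ 2 := by
  set e := MeasurableEquiv.piFinSuccAbove (fun _ : Fin (n + 1) => ℝ) m with he_def
  have he : MeasurePreserving e.symm (volume.prod volume) volume := by
    have := (volume_preserving_piFinSuccAbove (fun _ : Fin (n + 1) => ℝ) m).symm
    rwa [Measure.volume_eq_prod] at this
  have he_apply : ∀ p : ℝ × (Fin n → ℝ), e.symm p = Fin.insertNth m p.1 p.2 := fun p => by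
    rw [he_def, MeasurableEquiv.piFinSuccAbove_symm_apply]; rfl
  have hpre : e.symm ⁻¹' maynardCube (n + 1) = Icc (0:ℝ) 1 ×ˢ maynardCube n := by
    ext ⟨x, s⟩
    simp only [maynardCube, Set.mem_preimage, he_apply, Set.mem_pi, Set.mem_univ, true_implies,
      Set.mem_prod]
    rw [Fin.forall_iff_succAbove m]
    simp only [Fin.insertNth_apply_same, Fin.insertNth_apply_succAbove]
  rw [maynardJ, ← he.setIntegral_preimage_emb e.symm.measurableEmbedding, hpre]
  simp_rw [he_apply, Fin.update_insertNth]
  have := setIntegral_prod_mul (μ := (volume : Measure ℝ)) (ν := (volume : Measure (Fin n → ℝ)))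
    (fun _ : ℝ => (1:ℝ))
    (fun s : Fin n → ℝ => (∫ u in (0:ℝ)..1,
      (maynardSimplex (n + 1)).indicator F (Fin.insertNth m u s)) ^ 2) (Icc 0 1) (maynardCube n)
  simp only [one_mul] at this
  rw [this]
  simp

/-- Membership of `Fin.insertNth m u s` in `R_{n+1}`. [folklore] -/
theorem insertNth_mem_maynardSimplex_iff {n : ℕ} (m : Fin (n + 1)) (u : ℝ) (s : Fin n → ℝ) :
    (Fin.insertNth m u s : Fin (n + 1) → ℝ) ∈ maynardSimplex (n + 1) ↔
      (∀ i, 0 ≤ s i) ∧ 0 ≤ u ∧ u + ∑ i, s i ≤ 1 := by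
  simp only [maynardSimplex, Set.mem_setOf_eq]
  rw [Fin.forall_iff_succAbove m, Fin.sum_univ_succAbove _ m]
  simp only [Fin.insertNth_apply_same, Fin.insertNth_apply_succAbove]
  tauto

/-- `[0,1]^n ∩ R_n = R_n`. [folklore] -/
theorem maynardCube_inter_maynardSimplex (n : ℕ) :
    maynardCube n ∩ maynardSimplex n = maynardSimplex n :=
  Set.inter_eq_right.2 (maynardSimplex_subset_maynardCube n)

/-- **`J^{(m)}` of a cut-off function** (Maynard 2015, (7.3) and the first display in the proof of
Lemma 7.2): for `F = 1_{R_{n+1}} · P`,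
`J_{n+1}^{(m)}(F) = ∫_{R_n} (∫₀^{1 − ∑ sᵢ} P(s with u inserted at m) du)² ds`.
[cite: MaynardAnnals2015, proof of Lemma 7.2] -/
theorem maynardJ_indicator_eq {n : ℕ} (m : Fin (n + 1)) (P : (Fin (n + 1) → ℝ) → ℝ) :
    maynardJ (n + 1) m ((maynardSimplex (n + 1)).indicator P) = ∫ s in maynardSimplex n,
      (∫ u in (0:ℝ)..(1 - ∑ i, s i), P (Fin.insertNth m u s)) ^ 2 := by
  rw [maynardJ_succ_eq, Set.indicator_indicator, Set.inter_self, ← maynardCube_inter_maynardSimplex n,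
    ← setIntegral_indicator (measurableSet_maynardSimplex n)]
  refine setIntegral_congr_fun (MeasurableSet.univ_pi fun _ => measurableSet_Icc) fun s hs => ?_
  have hs0 : ∀ i, 0 ≤ s i := fun i => (hs i (Set.mem_univ i)).1
  by_cases hS : ∑ i, s i ≤ 1
  · have hmem : s ∈ maynardSimplex n := ⟨hs0, hS⟩
    rw [Set.indicator_of_mem hmem]
    congr 1
    have hind : ∀ u, (maynardSimplex (n + 1)).indicator P (Fin.insertNth m u s) =
        (Icc 0 (1 - ∑ i, s i)).indicator (fun u => P (Fin.insertNth m u s)) u := by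
      intro u
      by_cases hu : u ∈ Icc 0 (1 - ∑ i, s i)
      · rw [Set.indicator_of_mem hu, Set.indicator_of_mem]
        exact (insertNth_mem_maynardSimplex_iff m u s).2 ⟨hs0, hu.1, by linarith [hu.2]⟩
      · rw [Set.indicator_of_notMem hu, Set.indicator_of_notMem]
        intro h
        obtain ⟨-, h0, h1⟩ := (insertNth_mem_maynardSimplex_iff m u s).1 h
        exact hu ⟨h0, by linarith⟩
    simp_rw [hind]
    have hw0 : 0 ≤ 1 - ∑ i, s i := by linarith
    have hw1 : 1 - ∑ i, s i ≤ 1 := by linarith [Finset.sum_nonneg fun i (_ : i ∈ Finset.univ) => hs0 i]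
    have hset : Ioc (0:ℝ) 1 ∩ Icc 0 (1 - ∑ i, s i) = Ioc 0 (1 - ∑ i, s i) := by
      ext u
      simp only [Set.mem_inter_iff, Set.mem_Ioc, Set.mem_Icc]
      constructor
      · rintro ⟨⟨h1, -⟩, -, h3⟩; exact ⟨h1, h3⟩
      · rintro ⟨h1, h2⟩; exact ⟨⟨h1, h2.trans hw1⟩, h1.le, h2⟩
    rw [intervalIntegral.integral_of_le zero_le_one, intervalIntegral.integral_of_le hw0,
      setIntegral_indicator measurableSet_Icc, hset]
  · have hnmem : s ∉ maynardSimplex n := fun h => hS h.2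
    rw [Set.indicator_of_notMem hnmem]
    have hind : ∀ u, (maynardSimplex (n + 1)).indicator P (Fin.insertNth m u s) = 0 := by
      intro u
      refine Set.indicator_of_notMem (fun h => ?_) _
      obtain ⟨-, h0, h1⟩ := (insertNth_mem_maynardSimplex_iff m u s).1 h
      exact hS (by linarith)
    simp_rw [hind]
    simp

/-- `I_k(1_{R_k} · P) = ∫_{R_k} P²` (Maynard 2015, first display in the proof of Lemma 7.2).
[cite: MaynardAnnals2015, proof of Lemma 7.2] -/
theorem maynardI_indicator_eq (k : ℕ) (P : (Fin k → ℝ) → ℝ) :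
    maynardI k ((maynardSimplex k).indicator P) = ∫ t in maynardSimplex k, P t ^ 2 := by
  rw [maynardI]
  refine setIntegral_congr_fun (measurableSet_maynardSimplex k) fun t ht => ?_
  simp only [Set.indicator_of_mem ht]

/-- A cut-off continuous function `F = 1_{R_k} · P` with `∫_{R_k} P² > 0` is an admissible test
function in the sense of `IsMaynardAdmissible` (Maynard 2015, (7.3): the class used in §7).
[cite: MaynardAnnals2015, §7 (7.3)] -/
theorem isMaynardAdmissible_indicator {k : ℕ} {P : (Fin k → ℝ) → ℝ} (hP : Continuous P)
    (hpos : 0 < ∫ t in maynardSimplex k, P t ^ 2) :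
    IsMaynardAdmissible k ((maynardSimplex k).indicator P) where
  measurable := hP.measurable.indicator (measurableSet_maynardSimplex k)
  support_subset := Set.support_indicator_subset
  integrableOn_sq := by
    have h : IntegrableOn (fun t => P t ^ 2) (maynardSimplex k) :=
      (hP.pow 2).continuousOn.integrableOn_compact (isCompact_maynardSimplex k)
    refine (integrableOn_congr_fun (fun t ht => ?_) (measurableSet_maynardSimplex k)).2 h
    simp only [Set.indicator_of_mem ht]
  maynardI_pos := by rwa [maynardI_indicator_eq]

/-! ### Moments of `(1 − P₁)^a P₂^b`, `b ≤ 2`, packaged -/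

/-- The values `∫_{R_k} (1 − P₁)^a P₂^b` for `b = 0, 1, 2` (Maynard 2015, Lemma 7.1 with `j = 2`:
`a! G_{b,2}(k)/(k + 2b + a)!`, `G_{0,2} = 1`, `G_{1,2}(k) = 2k`, `G_{2,2}(k) = 4k² + 20k`); the
value for `b ≥ 3` is a placeholder and is not used. [cite: MaynardAnnals2015, Lemma 7.1] -/
def simplexMoment (k a : ℕ) : ℕ → ℝ
  | 0 => (a ! : ℝ) / (k + a)!
  | 1 => (2 * k * a ! : ℝ) / (k + a + 2)!
  | _ + 2 => ((4 * k ^ 2 + 20 * k) * a ! : ℝ) / (k + a + 4)!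

/-- **Maynard 2015, Lemma 7.1 (`j = 2`, `b ≤ 2`)**: `∫_{R_k} (1 − P₁)^a P₂^b = simplexMoment k a b`.
[cite: MaynardAnnals2015, Lemma 7.1] -/
theorem setIntegral_simplex_monomial (k a : ℕ) {b : ℕ} (hb : b ≤ 2) :
    ∫ t in maynardSimplex k, (1 - ∑ i, t i) ^ a * (∑ i, t i ^ 2) ^ b = simplexMoment k a b := by
  interval_cases b
  · simp_rw [pow_zero, mul_one]
    exact setIntegral_simplex_oneSubPow k a
  · simp_rw [pow_one]
    exact setIntegral_simplex_oneSubPow_mul_powSumTwo k a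
  · exact setIntegral_simplex_oneSubPow_mul_powSumTwo_sq k a

/-- Linearity: the integral over `R_k` of a finite combination `∑ⱼ cⱼ (1 − P₁)^{aⱼ} P₂^{bⱼ}` with all
`bⱼ ≤ 2` (Maynard 2015, Lemma 7.2, first display of the proof). [cite: MaynardAnnals2015, proof of Lemma 7.2] -/
theorem setIntegral_simplex_sum_monomial {n : ℕ} (k : ℕ) (c : Fin n → ℝ) (a b : Fin n → ℕ)
    (hb : ∀ j, b j ≤ 2) :
    ∫ t in maynardSimplex k, ∑ j, c j * ((1 - ∑ i, t i) ^ (a j) * (∑ i, t i ^ 2) ^ (b j)) =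
      ∑ j, c j * simplexMoment k (a j) (b j) := by
  have hint : ∀ j : Fin n, IntegrableOn
      (fun t : Fin k → ℝ => c j * ((1 - ∑ i, t i) ^ (a j) * (∑ i, t i ^ 2) ^ (b j)))
      (maynardSimplex k) := fun j =>
    (by fun_prop : Continuous fun t : Fin k → ℝ =>
      c j * ((1 - ∑ i, t i) ^ (a j) * (∑ i, t i ^ 2) ^ (b j))).continuousOn.integrableOn_compact
        (isCompact_maynardSimplex k)
  rw [integral_finsetSum _ fun j _ => hint j]
  refine Finset.sum_congr rfl fun j _ => ?_
  rw [MeasureTheory.integral_const_mul, setIntegral_simplex_monomial k (a j) (hb j)]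

/-! ### Power sums after inserting a coordinate -/

/-- `P₁` after inserting `u` at place `m`: `∑ᵢ (insertNth m u s)ᵢ = u + ∑ⱼ sⱼ`. [folklore] -/
theorem sum_insertNth_eq {n : ℕ} (m : Fin (n + 1)) (u : ℝ) (s : Fin n → ℝ) :
    ∑ i, (Fin.insertNth m u s : Fin (n + 1) → ℝ) i = u + ∑ j, s j :=
  Fin.sum_insertNth m u s

/-- `P₂` after inserting `u` at place `m`: `∑ᵢ (insertNth m u s)ᵢ² = u² + ∑ⱼ sⱼ²`. [folklore] -/
theorem sum_sq_insertNth_eq {n : ℕ} (m : Fin (n + 1)) (u : ℝ) (s : Fin n → ℝ) :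
    ∑ i, (Fin.insertNth m u s : Fin (n + 1) → ℝ) i ^ 2 = u ^ 2 + ∑ j, s j ^ 2 := by
  rw [Fin.sum_univ_succAbove _ m, Fin.insertNth_apply_same]
  simp only [Fin.insertNth_apply_succAbove]

/-! ### Maynard's polynomial for `k = 5` -/

/-- Maynard's polynomial for `k = 5` as a function of `w = 1 − P₁` and `s = P₂`:
`P = w s + 7/10 w² + 1/14 s − 3/14 w` (Maynard 2015, (7.21)). [cite: MaynardAnnals2015, §7 (7.21)] -/
def maynardPoly5 (w s : ℝ) : ℝ :=
  w * s + 7 / 10 * w ^ 2 + 1 / 14 * s - 3 / 14 * w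

/-- Maynard's test function for `k = 5`: `F = 1_{R_5} · P(1 − P₁, P₂)` (Maynard 2015, (7.3) with the
`P` of (7.21)). [cite: MaynardAnnals2015, §7 (7.3), (7.21)] -/
def maynardF5 : (Fin 5 → ℝ) → ℝ :=
  (maynardSimplex 5).indicator fun t => maynardPoly5 (1 - ∑ i, t i) (∑ i, t i ^ 2)

/-- Continuity of `t ↦ P(1 − P₁(t), P₂(t))`. [folklore] -/
theorem continuous_maynardPoly5_comp :
    Continuous fun t : Fin 5 → ℝ => maynardPoly5 (1 - ∑ i, t i) (∑ i, t i ^ 2) := by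
  unfold maynardPoly5
  fun_prop

/-- Coefficients of the nine monomials `(1 − P₁)^a P₂^b` of `P²` for the `P` of (7.21).
[cite: MaynardAnnals2015, proof of Lemma 7.2, (7.16) applied to (7.21)] -/
def cI : Fin 9 → ℝ := ![1, 1 / 7, 1 / 196, 7 / 5, -23 / 70, -3 / 98, 49 / 100, -3 / 10, 9 / 196]

/-- `(1 − P₁)`-exponents of the nine monomials of `P²` for the `P` of (7.21).
[cite: MaynardAnnals2015, proof of Lemma 7.2, (7.16) applied to (7.21)] -/
def aI : Fin 9 → ℕ := ![2, 1, 0, 3, 2, 1, 4, 3, 2]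

/-- `P₂`-exponents of the nine monomials of `P²` for the `P` of (7.21).
[cite: MaynardAnnals2015, proof of Lemma 7.2, (7.16) applied to (7.21)] -/
def bI : Fin 9 → ℕ := ![2, 2, 2, 1, 1, 1, 0, 0, 0]

/-- `P² = ∑ⱼ cⱼ (1 − P₁)^{aⱼ} P₂^{bⱼ}` (nine monomials). [cite: MaynardAnnals2015, proof of Lemma 7.2] -/
theorem maynardPoly5_sq (w s : ℝ) :
    maynardPoly5 w s ^ 2 = ∑ j, cI j * (w ^ (aI j) * s ^ (bI j)) := by
  simp [Fin.sum_univ_succ, cI, aI, bI, maynardPoly5]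
  ring

/-- **`I_5(F) = 29509/1222452000`** for Maynard's `F` (Maynard 2015, Lemma 7.2 applied to (7.21)).
[cite: MaynardAnnals2015, Lemma 7.2 and (7.21)–(7.22)] -/
theorem maynardI_maynardF5 : maynardI 5 maynardF5 = 29509 / 1222452000 := by
  rw [maynardF5, maynardI_indicator_eq]
  simp_rw [maynardPoly5_sq]
  rw [setIntegral_simplex_sum_monomial 5 cI aI bI (by decide)]
  simp [Fin.sum_univ_succ, cI, aI, bI, simplexMoment, Nat.factorial]
  norm_num

/-- The inner integral `∫₀^w P dt_m` as a function of `w = 1 − P₁'` and `s = P₂'`: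
`s (w²/2 + w/14) + (w⁴/12 + 9/35 w³ − 3/28 w²)` (Maynard 2015, (7.18) for the `P` of (7.21)).
[cite: MaynardAnnals2015, proof of Lemma 7.2, (7.18)] -/
def maynardInner5 (w s : ℝ) : ℝ :=
  s * (w ^ 2 / 2 + w / 14) + (w ^ 4 / 12 + 9 / 35 * w ^ 3 - 3 / 28 * w ^ 2)

/-- **The `t_m`-integral of `P`** (Maynard 2015, (7.18)): with `P₁ = u + P₁'`, `P₂ = u² + P₂'` and
`w = 1 − P₁'`, `∫₀^w P du = maynardInner5 w P₂'`, by the fundamental theorem of calculus.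
[cite: MaynardAnnals2015, proof of Lemma 7.2, (7.18)] -/
theorem integral_maynardPoly5 (w s : ℝ) :
    ∫ u in (0:ℝ)..w, maynardPoly5 (w - u) (u ^ 2 + s) = maynardInner5 w s := by
  -- an explicit antiderivative and the fundamental theorem of calculus
  have hderiv : ∀ u ∈ Set.uIcc (0:ℝ) w, HasDerivAt
      (fun u : ℝ => (-1 / 4) * u ^ 4 + ((w + 7 / 10 + 1 / 14) / 3) * u ^ 3 +
        ((-s - 7 / 5 * w + 3 / 14) / 2) * u ^ 2 + (w * s + 7 / 10 * w ^ 2 + s / 14 - 3 / 14 * w) * u)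
      (maynardPoly5 (w - u) (u ^ 2 + s)) u := by
    intro u _
    have h := ((((hasDerivAt_pow 4 u).const_mul (-1 / 4 : ℝ)).fun_add
      ((hasDerivAt_pow 3 u).const_mul ((w + 7 / 10 + 1 / 14) / 3))).fun_add
      ((hasDerivAt_pow 2 u).const_mul ((-s - 7 / 5 * w + 3 / 14) / 2))).fun_add
      ((hasDerivAt_id' u).const_mul (w * s + 7 / 10 * w ^ 2 + s / 14 - 3 / 14 * w))
    refine h.congr_deriv ?_
    simp only [maynardPoly5]
    norm_num
    ring
  rw [intervalIntegral.integral_eq_sub_of_hasDerivAt hderiv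
    ((by unfold maynardPoly5; fun_prop :
      Continuous fun u : ℝ => maynardPoly5 (w - u) (u ^ 2 + s)).intervalIntegrable 0 w)]
  simp only [maynardInner5]
  ring

/-- Coefficients of the twelve monomials `w^a s^b` of `(maynardInner5 w s)²` (the square of the
`t_m`-integral (7.18)/(7.19) for the `P` of (7.21)).
[cite: MaynardAnnals2015, proof of Lemma 7.2, (7.19) applied to (7.21)] -/
def cJ : Fin 12 → ℝ :=
  ![1 / 196, -3 / 196, 1 / 14, 9 / 784, -69 / 980, 1 / 4, -27 / 490, 113 / 420, 473 / 9800, 1 / 12,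
    3 / 70, 1 / 144]

/-- `w`-exponents of the twelve monomials of `(maynardInner5 w s)²`.
[cite: MaynardAnnals2015, proof of Lemma 7.2, (7.19) applied to (7.21)] -/
def aJ : Fin 12 → ℕ := ![2, 3, 3, 4, 4, 4, 5, 5, 6, 6, 7, 8]

/-- `s`-exponents of the twelve monomials of `(maynardInner5 w s)²`.
[cite: MaynardAnnals2015, proof of Lemma 7.2, (7.19) applied to (7.21)] -/
def bJ : Fin 12 → ℕ := ![2, 1, 2, 0, 1, 2, 0, 1, 0, 1, 0, 0]

/-- `(maynardInner5 w s)² = ∑ⱼ cⱼ w^{aⱼ} s^{bⱼ}` (twelve monomials).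
[cite: MaynardAnnals2015, proof of Lemma 7.2, (7.19)] -/
theorem maynardInner5_sq (w s : ℝ) :
    maynardInner5 w s ^ 2 = ∑ j, cJ j * (w ^ (aJ j) * s ^ (bJ j)) := by
  simp [Fin.sum_univ_succ, cJ, aJ, bJ, maynardInner5]
  ring

/-- **`J_5^{(m)}(F) = 40493/4191264000`** for Maynard's `F` and every `m` (Maynard 2015, Lemma 7.2
applied to (7.21)). [cite: MaynardAnnals2015, Lemma 7.2 and (7.21)–(7.22)] -/
theorem maynardJ_maynardF5 (m : Fin 5) : maynardJ 5 m maynardF5 = 40493 / 4191264000 := by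
  rw [maynardF5, maynardJ_indicator_eq]
  have hinner : ∀ s : Fin 4 → ℝ,
      ∫ u in (0:ℝ)..(1 - ∑ i, s i), (fun t : Fin 5 → ℝ => maynardPoly5 (1 - ∑ i, t i) (∑ i, t i ^ 2))
        (Fin.insertNth m u s) = maynardInner5 (1 - ∑ i, s i) (∑ i, s i ^ 2) := by
    intro s
    simp only [sum_insertNth_eq, sum_sq_insertNth_eq]
    have h : ∀ u : ℝ, 1 - (u + ∑ j, s j) = (1 - ∑ j, s j) - u := fun u => by ring
    simp_rw [h]
    exact integral_maynardPoly5 _ _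
  simp_rw [hinner, maynardInner5_sq]
  rw [setIntegral_simplex_sum_monomial 4 cJ aJ bJ (by decide)]
  simp [Fin.sum_univ_succ, cJ, aJ, bJ, simplexMoment, Nat.factorial]
  norm_num

/-- **Maynard 2015, (7.22)**: `(∑ₘ J_5^{(m)}(F)) / I_5(F) = 1417255/708216` for the `F` of (7.21).
[cite: MaynardAnnals2015, §7 (7.22)] -/
theorem maynardFunctional_maynardF5 : maynardFunctional 5 maynardF5 = 1417255 / 708216 := by
  rw [maynardFunctional, maynardI_maynardF5]
  simp_rw [maynardJ_maynardF5]
  rw [Finset.sum_const, Finset.card_univ, Fintype.card_fin, nsmul_eq_mul]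
  norm_num

/-- Maynard's `F` for `k = 5` is an admissible test function (`I_5(F) = 29509/1222452000 > 0`).
[cite: MaynardAnnals2015, §7 (7.3), (7.21)] -/
theorem isMaynardAdmissible_maynardF5 : IsMaynardAdmissible 5 maynardF5 := by
  refine isMaynardAdmissible_indicator continuous_maynardPoly5_comp ?_
  have h := maynardI_maynardF5
  rw [maynardF5, maynardI_indicator_eq] at h
  rw [h]
  norm_num

end MaynardTao

/-- **Maynard 2015, Proposition 4.3 (1), first part: `M_5 > 2`**, discharging the named fact
`Literature.NumberTheory.Sieve.exists_two_lt_maynardFunctional_five`: the cut-off polynomial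
`F = 1_{R_5} · ((1 − P₁)P₂ + 7/10 (1 − P₁)² + 1/14 P₂ − 3/14 (1 − P₁))` is admissible and has
`(∑ₘ J_5^{(m)}(F)) / I_5(F) = 1417255/708216 > 2` (Maynard, Ann. of Math. 181 (2015), §7, (7.21)–(7.22)).
[cite: MaynardAnnals2015, Proposition 4.3 (1) and §7 (7.21)–(7.22)] -/
theorem exists_two_lt_maynardFunctional_five_holds : exists_two_lt_maynardFunctional_five :=
  ⟨MaynardTao.maynardF5, MaynardTao.isMaynardAdmissible_maynardF5, by
    rw [MaynardTao.maynardFunctional_maynardF5]; norm_num⟩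

end Literature.NumberTheory.Sieve
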